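import Mathlib
import Summits.ValiantsHypothesis.ValiantsHypothesis.Theorems.BarrierLeverPartitionMinorsHitByVPSimplexJoinAbsorb

/-!
# Route BarrierLever — item `PartitionMinorsHitByVP` (stmt-ValiantsHypothesis-19717), line `hidden_states`:
# THE GREEDY PIECE CUT, part 1/2 — row-scaling one column block: the coefficient formula by weight

Helper file (`--supports stmt-ValiantsHypothesis-19717`; cell valiant-natproofs, rung V4, 𝒟-side door (c); prover seat
val-np-p3 gen 20). Pure linear algebra; three bookkeeping `def`s (the block-zeroed matrix `blockZero`, the row-scaled matrix
`rowScale`, its symbolic version `rowScaleX`). Closes NO item. Part 2 (`…HiddenStatesGreedyCut`) is the greedy cut itself.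

`SimplexJoin.coeff_det_rowScaled` (val-np-p3 g11, p611971 — the engine under `good_of_absorb(_join)` and the uniform-pieces
theorems) scales the columns `P` of a square matrix `N` by the row factors `X^{wt i}` and identifies the coefficient of the
extreme power ASSUMING the `|P|` lightest rows form a strict threshold slice. Here, for EVERY exponent `w`:

* `coeff_det_rowScale_eq_sum` — `coeff_w det (rowScaleX N P wt) = Σ_{R : |R| = |P|, Σ_{i∈R} wt i = w} det (blockZero N R P)`
  (generalised Laplace expansion along the columns `P`, grouped by row weight; per permutation `σ` the matched row set is
  `P.image σ`, `prod_blockZero_perm`, `prod_rowScaleX_perm`);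
* `det_blockZero_eq_zero` / `det_blockZero_eq_zero'` — `det (blockZero N R P) = 0` as soon as the block `R × P` has a right
  (resp. left) kernel vector.

WHAT THIS IS NOT: no design is proved good here; item 19717 stays OPEN; nothing on crux 14610 or VP ≠ VNP.
-/

set_option linter.dupNamespace false

namespace Summit.ValiantsHypothesis.ValiantsHypothesis.Theorems.BarrierLever.HiddenStates

open Finset Matrix

noncomputable section

namespace GreedyCut

variable {r : ℕ}

/-! ## 1. The block-zeroed and the row-scaled matrix; the coefficient formula -/

/-- `N` with the blocks `R × Pᶜ` and `Rᶜ × P` replaced by zero. -/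
def blockZero (N : Matrix (Fin r) (Fin r) ℂ) (R P : Finset (Fin r)) : Matrix (Fin r) (Fin r) ℂ :=
  Matrix.of fun i k : Fin r => if (i ∈ R ↔ k ∈ P) then N i k else 0

/-- `N` with its `P`-columns scaled by the row factors `c ^ wt i`. -/
def rowScale (N : Matrix (Fin r) (Fin r) ℂ) (P : Finset (Fin r)) (wt : Fin r → ℕ) (c : ℂ) :
    Matrix (Fin r) (Fin r) ℂ :=
  Matrix.of fun i k : Fin r => if k ∈ P then c ^ wt i * N i k else N i k

/-- The symbolic row-scaled matrix (scaling parameter `X`). -/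
def rowScaleX (N : Matrix (Fin r) (Fin r) ℂ) (P : Finset (Fin r)) (wt : Fin r → ℕ) :
    Matrix (Fin r) (Fin r) (Polynomial ℂ) :=
  Matrix.of fun i k : Fin r => if k ∈ P then Polynomial.C (N i k) * Polynomial.X ^ wt i else Polynomial.C (N i k)

/-- Evaluating the symbolic row-scaled determinant at `c` gives the determinant of `rowScale N P wt c`. -/
theorem eval_det_rowScaleX (N : Matrix (Fin r) (Fin r) ℂ) (P : Finset (Fin r)) (wt : Fin r → ℕ) (c : ℂ) :
    (rowScaleX N P wt).det.eval c = (rowScale N P wt c).det := by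
  rw [← Polynomial.coe_evalRingHom, RingHom.map_det, RingHom.mapMatrix_apply]
  congr 1
  refine Matrix.ext fun i k => ?_
  simp only [rowScaleX, rowScale, Matrix.map_apply, Matrix.of_apply, Polynomial.coe_evalRingHom]
  split_ifs with hk
  · rw [Polynomial.eval_mul, Polynomial.eval_C, Polynomial.eval_pow, Polynomial.eval_X, mul_comm]
  · rw [Polynomial.eval_C]

/-- For a permutation `σ`, the row set matched with `P` is `P.image σ`: `(∀ k, σ k ∈ R ↔ k ∈ P) ↔ R = P.image σ`. -/
theorem forall_mem_iff_eq_image (σ : Equiv.Perm (Fin r)) (R P : Finset (Fin r)) :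
    (∀ k, (σ k ∈ R ↔ k ∈ P)) ↔ R = P.image σ := by
  constructor
  · intro hk
    ext i
    rw [Finset.mem_image]
    constructor
    · intro hi
      exact ⟨σ.symm i, (hk _).mp (by simpa using hi), by simp⟩
    · rintro ⟨k, hkP, rfl⟩
      exact (hk k).mpr hkP
  · rintro rfl k
    rw [Finset.mem_image]
    constructor
    · rintro ⟨k', hk', hkk'⟩
      rwa [← σ.injective hkk']
    · intro hk
      exact ⟨k, hk, rfl⟩

/-- The `σ`-term of `det (blockZero N R P)`. -/
theorem prod_blockZero_perm (N : Matrix (Fin r) (Fin r) ℂ) (R P : Finset (Fin r)) (σ : Equiv.Perm (Fin r)) :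
    (∏ k : Fin r, blockZero N R P (σ k) k) =
      if R = P.image σ then ∏ k : Fin r, N (σ k) k else 0 := by
  classical
  by_cases hall : ∀ k, (σ k ∈ R ↔ k ∈ P)
  · rw [if_pos ((forall_mem_iff_eq_image σ R P).mp hall)]
    refine Finset.prod_congr rfl fun k _ => ?_
    rw [blockZero, Matrix.of_apply, if_pos (hall k)]
  · rw [if_neg (fun h => hall ((forall_mem_iff_eq_image σ R P).mpr h))]
    obtain ⟨k, hk⟩ := not_forall.mp hall
    exact Finset.prod_eq_zero (Finset.mem_univ k) (by rw [blockZero, Matrix.of_apply, if_neg hk])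

/-- The `σ`-term of `det (rowScaleX N P wt)`. -/
theorem prod_rowScaleX_perm (N : Matrix (Fin r) (Fin r) ℂ) (P : Finset (Fin r)) (wt : Fin r → ℕ)
    (σ : Equiv.Perm (Fin r)) :
    (∏ k : Fin r, rowScaleX N P wt (σ k) k) =
      Polynomial.C (∏ k : Fin r, N (σ k) k) * Polynomial.X ^ (∑ i ∈ P.image σ, wt i) := by
  classical
  simp only [rowScaleX, Matrix.of_apply]
  rw [← Finset.prod_filter_mul_prod_filter_not Finset.univ (fun k => k ∈ P)]
  have hfP : Finset.univ.filter (fun k : Fin r => k ∈ P) = P := by ext k; simp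
  have h1 : ∏ k ∈ Finset.univ.filter (fun k : Fin r => k ∈ P),
      (if k ∈ P then Polynomial.C (N (σ k) k) * Polynomial.X ^ wt (σ k) else Polynomial.C (N (σ k) k)) =
      ∏ k ∈ P, Polynomial.C (N (σ k) k) * Polynomial.X ^ wt (σ k) := by
    rw [hfP]
    exact Finset.prod_congr rfl fun k hk => by rw [if_pos hk]
  have h2 : ∏ k ∈ Finset.univ.filter (fun k : Fin r => ¬ k ∈ P),
      (if k ∈ P then Polynomial.C (N (σ k) k) * Polynomial.X ^ wt (σ k) else Polynomial.C (N (σ k) k)) =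
      ∏ k ∈ Finset.univ.filter (fun k : Fin r => ¬ k ∈ P), Polynomial.C (N (σ k) k) := by
    refine Finset.prod_congr rfl fun k hk => ?_
    rw [Finset.mem_filter] at hk
    rw [if_neg hk.2]
  rw [h1, h2, Finset.prod_mul_distrib, Finset.prod_pow_eq_pow_sum, ← map_prod Polynomial.C,
    ← map_prod Polynomial.C]
  have h3 : (∏ k : Fin r, N (σ k) k) = (∏ k ∈ P, N (σ k) k) *
      ∏ k ∈ Finset.univ.filter (fun k : Fin r => ¬ k ∈ P), N (σ k) k := by
    rw [← Finset.prod_filter_mul_prod_filter_not Finset.univ (fun k : Fin r => k ∈ P), hfP]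
  have h4 : ∑ i ∈ P.image σ, wt i = ∑ k ∈ P, wt (σ k) :=
    Finset.sum_image fun k _ k' _ hk => σ.injective hk
  rw [h3, h4, map_mul]
  ring

/-- **Coefficient formula (generalised Laplace expansion grouped by weight).** For every exponent `w`, the coefficient
of `X^w` in `det (rowScaleX N P wt)` is the sum of `det (blockZero N R P)` over the row sets `R` with `|R| = |P|` and
`Σ_{i∈R} wt i = w`. -/
theorem coeff_det_rowScale_eq_sum (N : Matrix (Fin r) (Fin r) ℂ) (P : Finset (Fin r)) (wt : Fin r → ℕ) (w : ℕ) :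
    (rowScaleX N P wt).det.coeff w =
      ∑ R ∈ (Finset.univ.powersetCard P.card).filter (fun R => ∑ i ∈ R, wt i = w),
        (blockZero N R P).det := by
  classical
  set S := (Finset.univ.powersetCard P.card).filter (fun R : Finset (Fin r) => ∑ i ∈ R, wt i = w) with hS
  have hmemS : ∀ R : Finset (Fin r), R ∈ S ↔ R.card = P.card ∧ ∑ i ∈ R, wt i = w := by
    intro R
    rw [hS, Finset.mem_filter, Finset.mem_powersetCard]
    simp
  rw [Matrix.det_apply', Polynomial.finsetSum_coeff]
  have hrhs : ∑ R ∈ S, (blockZero N R P).det =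
      ∑ σ : Equiv.Perm (Fin r), ∑ R ∈ S,
        (((Equiv.Perm.sign σ : ℤˣ) : ℤ) : ℂ) * ∏ k : Fin r, blockZero N R P (σ k) k := by
    simp only [Matrix.det_apply']
    rw [Finset.sum_comm]
  rw [hrhs]
  refine Finset.sum_congr rfl fun σ _ => ?_
  rw [prod_rowScaleX_perm]
  have hsign : (((Equiv.Perm.sign σ : ℤˣ) : ℤ) : Polynomial ℂ) =
      Polynomial.C ((((Equiv.Perm.sign σ : ℤˣ) : ℤ) : ℂ)) := by simp
  rw [hsign, ← mul_assoc, ← map_mul, Polynomial.coeff_C_mul_X_pow]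
  simp only [prod_blockZero_perm, mul_ite, mul_zero]
  rw [Finset.sum_ite, Finset.sum_const_zero, add_zero]
  have hcardim : (P.image σ).card = P.card := Finset.card_image_of_injective _ σ.injective
  by_cases hw : w = ∑ i ∈ P.image σ, wt i
  · rw [if_pos hw]
    have hfilt : S.filter (fun R => R = P.image σ) = {P.image σ} := by
      ext R
      rw [Finset.mem_filter, Finset.mem_singleton, hmemS]
      constructor
      · rintro ⟨-, h⟩; exact h
      · rintro rfl; exact ⟨⟨hcardim, hw.symm⟩, rfl⟩
    rw [hfilt, Finset.sum_singleton]
  · rw [if_neg hw]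
    have hfilt : S.filter (fun R => R = P.image σ) = ∅ := by
      ext R
      rw [Finset.mem_filter, hmemS]
      simp only [Finset.notMem_empty, iff_false, not_and]
      rintro ⟨-, hsum⟩ rfl
      exact hw hsum.symm
    rw [hfilt, Finset.sum_empty]

/-- If some vector supported on `P` is killed by the rows `R` of `N`, then `det (blockZero N R P) = 0`. -/
theorem det_blockZero_eq_zero (N : Matrix (Fin r) (Fin r) ℂ) (R P : Finset (Fin r)) (v : Fin r → ℂ)
    (hv : v ≠ 0) (hsupp : ∀ k, k ∉ P → v k = 0) (hker : ∀ i ∈ R, ∑ k ∈ P, N i k * v k = 0) :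
    (blockZero N R P).det = 0 := by
  classical
  rw [← Matrix.exists_mulVec_eq_zero_iff]
  refine ⟨v, hv, ?_⟩
  funext i
  rw [Matrix.mulVec, dotProduct, Pi.zero_apply]
  by_cases hi : i ∈ R
  · rw [← hker i hi, ← Finset.sum_filter_add_sum_filter_not Finset.univ (fun k => k ∈ P)]
    have hfP : Finset.univ.filter (fun k : Fin r => k ∈ P) = P := by ext k; simp
    rw [hfP]
    have h0 : ∑ k ∈ Finset.univ.filter (fun k : Fin r => ¬ k ∈ P), blockZero N R P i k * v k = 0 :=
      Finset.sum_eq_zero fun k hk => by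
        rw [Finset.mem_filter] at hk
        rw [hsupp k hk.2, mul_zero]
    rw [h0, add_zero]
    refine Finset.sum_congr rfl fun k hk => ?_
    rw [blockZero, Matrix.of_apply, if_pos (iff_of_true hi hk)]
  · refine Finset.sum_eq_zero fun k _ => ?_
    by_cases hk : k ∈ P
    · rw [blockZero, Matrix.of_apply, if_neg (fun h => hi (h.mpr hk)), zero_mul]
    · rw [hsupp k hk, mul_zero]


/-- Row version: if some vector supported on `R` kills the columns `P` of `N` from the left, then
`det (blockZero N R P) = 0`. -/
theorem det_blockZero_eq_zero' (N : Matrix (Fin r) (Fin r) ℂ) (R P : Finset (Fin r)) (g : Fin r → ℂ)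
    (hg : g ≠ 0) (hsupp : ∀ i, i ∉ R → g i = 0) (hker : ∀ k ∈ P, ∑ i ∈ R, g i * N i k = 0) :
    (blockZero N R P).det = 0 := by
  classical
  rw [← Matrix.exists_vecMul_eq_zero_iff]
  refine ⟨g, hg, ?_⟩
  funext k
  rw [Matrix.vecMul, dotProduct, Pi.zero_apply]
  by_cases hk : k ∈ P
  · rw [← hker k hk, ← Finset.sum_filter_add_sum_filter_not Finset.univ (fun i => i ∈ R)]
    have hfR : Finset.univ.filter (fun i : Fin r => i ∈ R) = R := by ext i; simp
    rw [hfR]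
    have h0 : ∑ i ∈ Finset.univ.filter (fun i : Fin r => ¬ i ∈ R), g i * blockZero N R P i k = 0 :=
      Finset.sum_eq_zero fun i hi => by
        rw [Finset.mem_filter] at hi
        rw [hsupp i hi.2, zero_mul]
    rw [h0, add_zero]
    refine Finset.sum_congr rfl fun i hi => ?_
    rw [blockZero, Matrix.of_apply, if_pos (iff_of_true hi hk)]
  · refine Finset.sum_eq_zero fun i _ => ?_
    by_cases hi : i ∈ R
    · rw [blockZero, Matrix.of_apply, if_neg (fun h => hk (h.mp hi)), mul_zero]
    · rw [hsupp i hi, zero_mul]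

end GreedyCut

end

end Summit.ValiantsHypothesis.ValiantsHypothesis.Theorems.BarrierLever.HiddenStates
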